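import Summits.HubbardSuperconductivity.HubbardSuperconductivity.Theorems.WidthHaldaneColumnCorrelatorBounds

/-!
# The column factorisation of `WidthHaldaneBridge` is exact

Crux `WidthHaldaneBridge` (stmt-HubbardSuperconductivity-16311; routes `WidthHaldane`, `SeamInduction`)
asserts, under width-uniform tube thermodynamics `UniformThermo`, the Haldane-form lower bound
`A·L·M²·r̂^{-Ξ√(ẽ″/ρ̃)/M} ≤ G_ψ(r)` on the column `d_{x²-y²}` pair correlator
`G_ψ(r) = tubeColumnPairCorr L M Λ e ψ r` of every normalised sector ground state of every even
tube. The registered line `column_factorisation` (`Cruxes/WidthHaldaneBridge/Lines/column_factorisation.lean`)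
cuts the crux inside one tube and one state into factor **T** (equal-column weight
`A₀·L·M² ≤ G_ψ(0)`, width-uniform `A₀`) and factor **L** (the amplitude-free law
`a·G_ψ(0)·r̂^{-Ξ√(ẽ″/ρ̃)/M} ≤ G_ψ(r)`). Using the kinematic bounds `G_ψ(r) ≤ G_ψ(0) ≤ 32·L·M²`
(`Theorems/WidthHaldaneColumnCorrelatorBounds.lean`) this file proves that the cut is LOSSLESS:

* `columnWeight_of_widthHaldaneBridge` — **crux ⇒ factor T** (`A₀ = A·R'^{-Ξ√(k₀/d₀)}`,
  `R' = max(R,1)`: read the law at `r̂ = R'`, use `G_ψ(0) ≥ G_ψ(R')` and the exponent budget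
  `Ξ√(ẽ″/ρ̃)/M ≤ Ξ√(k₀/d₀)` under `UniformThermo`, `exponent_le_budget`);
* `not_widthHaldaneBridge_of_columnWeight_failure` — the contrapositive: a window point with
  width-uniform thermodynamics but NO width-uniform equal-column weight (the strategist's
  `SelectionFailure`: triplet / `q_y = π` / non-`B1g` condensate, all energy-blind) refutes the crux;
* `relativeLaw_of_widthHaldaneBridge` — **crux ⇒ factor L** with `a = A/32` (kinematic ceiling);
* `widthHaldaneBridge_of_columnWeight_of_relativeLaw` — the seam **T → L → crux** over the named
  tube vocabulary, and `widthHaldaneBridge_iff_columnFactorisation` — **crux ⟺ T ∧ L**: the line's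
  two stubs are jointly EQUIVALENT to the crux, so their (conjecture-strength) grading transfers to
  the crux one-to-one.

No physics is used. Sources for the objects only: Haldane, PRL 47 (1981) 1840 (form of the law);
Scalapino, Phys. Rep. 250 (1995) 329, §2 (the pair field).
-/

noncomputable section

namespace Summit.HubbardSuperconductivity.HubbardSuperconductivity.Theorems.WidthHaldane

set_option linter.dupNamespace false -- summit = problem name (single-conjunct summit), D-0017

open scoped BigOperators Classical Matrix ComplexConjugate
open Matrix Literature.MathematicalPhysics.QuantumLattice
open Summit.HubbardSuperconductivity.HubbardSuperconductivity.Theses.WidthHaldane (WidthHaldaneBridge)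

/-! ### Crux ⇒ factor T, and the `SelectionFailure` contrapositive -/

/-- Exponent budget: under `d₀ ≤ ρ̃`, `0 < ẽ″ ≤ k₀`, `0 < d₀` and `1 ≤ M`, the crux's exponent
`Ξ√(ẽ″/ρ̃)/M` is at most `Ξ√(k₀/d₀)` (for `Ξ ≥ 0`). [folklore] -/
theorem exponent_le_budget {Ξ d₀ k₀ stiff icomp M : ℝ} (hΞ : 0 ≤ Ξ) (hd₀ : 0 < d₀)
    (hstiff : d₀ ≤ stiff) (hic : 0 < icomp) (hick : icomp ≤ k₀) (hM : 1 ≤ M) :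
    Ξ * Real.sqrt (icomp / stiff) / M ≤ Ξ * Real.sqrt (k₀ / d₀) := by
  have hstiff0 : 0 < stiff := hd₀.trans_le hstiff
  have hratio : icomp / stiff ≤ k₀ / d₀ := by
    rw [div_le_div_iff₀ hstiff0 hd₀]
    nlinarith
  have hnn : 0 ≤ Ξ * Real.sqrt (icomp / stiff) := mul_nonneg hΞ (Real.sqrt_nonneg _)
  calc Ξ * Real.sqrt (icomp / stiff) / M ≤ Ξ * Real.sqrt (icomp / stiff) :=
        div_le_self hnn hM
    _ ≤ Ξ * Real.sqrt (k₀ / d₀) := mul_le_mul_of_nonneg_left (Real.sqrt_le_sqrt hratio) hΞ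

/-- **Crux ⇒ factor T (width-uniform equal-column weight).** If `WidthHaldaneBridge` holds then,
for every `U > 0`, `δ ∈ (0, 3/10)` and data with `UniformThermo`, there are `A₀ > 0`, `M₂`, `L₁` such
that every normalised `(N_{L,M}, S^z = 0)` sector ground state of every even tube
(`M₂ ≤ M ≤ L`, `L ≥ L₁`, any labelling) has `A₀·L·M² ≤ G_ψ(0)`. Proof: read the law at the
displacement `r = R' := max(R, 1)` (admissible once `L ≥ 2R' + 1`), use `G_ψ(R') ≤ G_ψ(0)` and bound
the exponent by `Ξ√(k₀/d₀)` (`exponent_le_budget`), so `A₀ := A·R'^{-Ξ√(k₀/d₀)}` works. [folklore] -/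
theorem columnWeight_of_widthHaldaneBridge (h : WidthHaldaneBridge) :
    ∀ U : ℝ, 0 < U → ∀ δ ∈ Set.Ioo (0 : ℝ) (3 / 10), ∀ (d₀ k₀ : ℝ) (M₁ L₀ : ℕ), 0 < d₀ →
      UniformThermo U δ d₀ k₀ M₁ L₀ →
        ∃ A₀ : ℝ, 0 < A₀ ∧ ∃ M₂ L₁ : ℕ, ∀ (L M : ℕ) [NeZero L] [NeZero M], Even L → Even M →
          M₂ ≤ M → M ≤ L → L₁ ≤ L → ∀ (Λ : Type) [LinearOrder Λ] [Fintype Λ]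
            (e : Λ ≃ ZMod L × ZMod M) (ψ : Fock (Orb Λ)), star ψ ⬝ᵥ ψ = 1 →
              IsGroundStateInSector (tubeH0 L M Λ e U) (tubeFilling L M δ) 0 ψ →
                A₀ * (L : ℝ) * (M : ℝ) ^ 2 ≤ tubeColumnPairCorr L M Λ e ψ 0 := by
  intro U hU δ hδ d₀ k₀ M₁ L₀ hd₀ hth
  obtain ⟨Ξ, hΞ, A, hA, R, M₂, L₁, hlaw⟩ :=
    (widthHaldaneBridge_iff.mp h) U hU δ hδ d₀ k₀ M₁ L₀ hd₀ hth
  set R' : ℕ := max R 1 with hR'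
  set C : ℝ := Ξ * Real.sqrt (k₀ / d₀) with hC
  have hR'pos : (0 : ℝ) < R' := by exact_mod_cast (le_max_right R 1 : 1 ≤ R')
  refine ⟨A * (R' : ℝ) ^ (-C), mul_pos hA (Real.rpow_pos_of_pos hR'pos _), max M₂ (max M₁ 1),
    max L₁ (max L₀ (2 * R' + 1)), ?_⟩
  intro L M _ _ hLe hMe hM hML hL Λ _ _ e ψ hψ hGS
  have hM₂ : M₂ ≤ M := le_of_max_le_left hM
  have hM₁ : M₁ ≤ M := le_of_max_le_left (le_of_max_le_right hM)
  have hM1 : 1 ≤ M := le_of_max_le_right (le_of_max_le_right hM)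
  have hL₁ : L₁ ≤ L := le_of_max_le_left hL
  have hL₀ : L₀ ≤ L := le_of_max_le_left (le_of_max_le_right hL)
  have hLR : 2 * R' + 1 ≤ L := le_of_max_le_right (le_of_max_le_right hL)
  obtain ⟨hstiff, hic, hick⟩ := hth L M hLe hMe hM₁ hML hL₀ Λ e
  -- the admissible displacement `r = R'`
  have hR'L : R' < L := by omega
  have hval : ((R' : ℕ) : ZMod L).val = R' := by
    rw [ZMod.val_natCast, Nat.mod_eq_of_lt hR'L]
  have h1 := hlaw L M hLe hMe hM₂ hML hL₁ Λ e ψ hψ hGS ((R' : ℕ) : ZMod L)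
    (by rw [hval]; exact le_max_left R 1) (by rw [hval]; omega)
  have hmin : min ((R' : ℕ) : ZMod L).val (L - ((R' : ℕ) : ZMod L).val) = R' := by
    rw [hval]; exact min_eq_left (by omega)
  rw [hmin] at h1
  have h2 := tubeColumnPairCorr_le_zero L M Λ e ψ ((R' : ℕ) : ZMod L)
  -- exponent comparison
  have hx : Ξ * Real.sqrt (tubePairCompressibility L M Λ e U δ / tubeStiffness L M Λ e U δ) / (M : ℝ)
      ≤ C := exponent_le_budget hΞ.le hd₀ hstiff hic hick (by exact_mod_cast hM1)
  have hR'1 : (1 : ℝ) ≤ R' := by exact_mod_cast (le_max_right R 1 : 1 ≤ R')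
  have hpow : (R' : ℝ) ^ (-C) ≤ (R' : ℝ) ^
      (-(Ξ * Real.sqrt (tubePairCompressibility L M Λ e U δ / tubeStiffness L M Λ e U δ) / (M : ℝ))) :=
    Real.rpow_le_rpow_of_exponent_le hR'1 (neg_le_neg hx)
  have hLM : 0 ≤ A * (L : ℝ) * (M : ℝ) ^ 2 := by positivity
  calc A * (R' : ℝ) ^ (-C) * (L : ℝ) * (M : ℝ) ^ 2
      = A * (L : ℝ) * (M : ℝ) ^ 2 * (R' : ℝ) ^ (-C) := by ring
    _ ≤ A * (L : ℝ) * (M : ℝ) ^ 2 * (R' : ℝ) ^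
          (-(Ξ * Real.sqrt (tubePairCompressibility L M Λ e U δ / tubeStiffness L M Λ e U δ) /
            (M : ℝ))) := mul_le_mul_of_nonneg_left hpow hLM
    _ ≤ tubeColumnPairCorr L M Λ e ψ ((R' : ℕ) : ZMod L) := h1
    _ ≤ tubeColumnPairCorr L M Λ e ψ 0 := h2

/-- **A `SelectionFailure` point refutes the crux.** If at some window point `(U, δ)` the tubes have
width-uniform thermodynamics for some data, yet for every candidate weight `A₀ > 0` and all
thresholds `M₂, L₁` some admissible even tube carries a normalised sector ground state with
`G_ψ(0) < A₀·L·M²` (no width-uniform equal-column pair weight — the energy-blind failure modes: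
triplet, `q_y = π` or non-`B1g` condensates), then `WidthHaldaneBridge` is false. Contrapositive
of `columnWeight_of_widthHaldaneBridge`. [folklore] -/
theorem not_widthHaldaneBridge_of_columnWeight_failure
    (hSF : ∃ U : ℝ, 0 < U ∧ ∃ δ ∈ Set.Ioo (0 : ℝ) (3 / 10), ∃ (d₀ k₀ : ℝ) (M₁ L₀ : ℕ), 0 < d₀ ∧
      UniformThermo U δ d₀ k₀ M₁ L₀ ∧
        ∀ A₀ : ℝ, 0 < A₀ → ∀ M₂ L₁ : ℕ, ∃ (L M : ℕ) (_ : NeZero L) (_ : NeZero M),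
          Even L ∧ Even M ∧ M₂ ≤ M ∧ M ≤ L ∧ L₁ ≤ L ∧
            ∃ (Λ : Type) (_ : LinearOrder Λ) (_ : Fintype Λ) (e : Λ ≃ ZMod L × ZMod M)
              (ψ : Fock (Orb Λ)), star ψ ⬝ᵥ ψ = 1 ∧
                IsGroundStateInSector (tubeH0 L M Λ e U) (tubeFilling L M δ) 0 ψ ∧
                  tubeColumnPairCorr L M Λ e ψ 0 < A₀ * (L : ℝ) * (M : ℝ) ^ 2) :
    ¬ WidthHaldaneBridge := by
  intro h
  obtain ⟨U, hU, δ, hδ, d₀, k₀, M₁, L₀, hd₀, hth, hfail⟩ := hSF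
  obtain ⟨A₀, hA₀, M₂, L₁, hT⟩ := columnWeight_of_widthHaldaneBridge h U hU δ hδ d₀ k₀ M₁ L₀ hd₀ hth
  obtain ⟨L, M, _, _, hLe, hMe, hM, hML, hL, Λ, _, _, e, ψ, hψ, hGS, hlt⟩ := hfail A₀ hA₀ M₂ L₁
  exact absurd (hT L M hLe hMe hM hML hL Λ e ψ hψ hGS) (not_le.mpr hlt)

/-! ### Crux ⇒ factor L, and the exact factorisation -/

/-- **Crux ⇒ factor L (amplitude-free law).** If `WidthHaldaneBridge` holds then, under
`UniformThermo`, every normalised sector ground state obeys the RELATIVE Haldane-form law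
`a·G_ψ(0)·r̂^{-Ξ√(ẽ″/ρ̃)/M} ≤ G_ψ(r)` with `a = A/32` (kinematic ceiling `G_ψ(0) ≤ 32·L·M²`) and the
crux's own `Ξ, R, M₂, L₁`. [folklore] -/
theorem relativeLaw_of_widthHaldaneBridge (h : WidthHaldaneBridge) :
    ∀ U : ℝ, 0 < U → ∀ δ ∈ Set.Ioo (0 : ℝ) (3 / 10), ∀ (d₀ k₀ : ℝ) (M₁ L₀ : ℕ), 0 < d₀ →
      UniformThermo U δ d₀ k₀ M₁ L₀ →
        ∃ Ξ : ℝ, 0 < Ξ ∧ ∃ a : ℝ, 0 < a ∧ ∃ R M₂ L₁ : ℕ, ∀ (L M : ℕ) [NeZero L] [NeZero M],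
          Even L → Even M → M₂ ≤ M → M ≤ L → L₁ ≤ L → ∀ (Λ : Type) [LinearOrder Λ] [Fintype Λ]
            (e : Λ ≃ ZMod L × ZMod M) (ψ : Fock (Orb Λ)), star ψ ⬝ᵥ ψ = 1 →
              IsGroundStateInSector (tubeH0 L M Λ e U) (tubeFilling L M δ) 0 ψ →
                ∀ r : ZMod L, R ≤ r.val → r.val + R ≤ L →
                  a * tubeColumnPairCorr L M Λ e ψ 0 *
                      ((min r.val (L - r.val) : ℕ) : ℝ) ^
                        (-(Ξ * Real.sqrt (tubePairCompressibility L M Λ e U δ /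
                          tubeStiffness L M Λ e U δ) / (M : ℝ))) ≤
                    tubeColumnPairCorr L M Λ e ψ r := by
  intro U hU δ hδ d₀ k₀ M₁ L₀ hd₀ hth
  obtain ⟨Ξ, hΞ, A, hA, R, M₂, L₁, hlaw⟩ :=
    (widthHaldaneBridge_iff.mp h) U hU δ hδ d₀ k₀ M₁ L₀ hd₀ hth
  refine ⟨Ξ, hΞ, A / 32, by positivity, R, M₂, L₁, ?_⟩
  intro L M _ _ hLe hMe hM hML hL Λ _ _ e ψ hψ hGS r hr hrL
  have h1 := hlaw L M hLe hMe hM hML hL Λ e ψ hψ hGS r hr hrL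
  have h0 := tubeColumnPairCorr_zero_le L M Λ e hψ
  have hx : 0 ≤ ((min r.val (L - r.val) : ℕ) : ℝ) ^
      (-(Ξ * Real.sqrt (tubePairCompressibility L M Λ e U δ / tubeStiffness L M Λ e U δ) /
        (M : ℝ))) := Real.rpow_nonneg (Nat.cast_nonneg _) _
  calc A / 32 * tubeColumnPairCorr L M Λ e ψ 0 * _
      ≤ A / 32 * (32 * (L : ℝ) * (M : ℝ) ^ 2) * _ :=
        mul_le_mul_of_nonneg_right (mul_le_mul_of_nonneg_left h0 (by positivity)) hx
    _ = A * (L : ℝ) * (M : ℝ) ^ 2 * _ := by ring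
    _ ≤ tubeColumnPairCorr L M Λ e ψ r := h1

/-- **Factor T and factor L give the crux** (the seam of line `column_factorisation`, over the named
tube vocabulary): `A₀·L·M² ≤ G_ψ(0)` and `a·G_ψ(0)·x ≤ G_ψ(r)` with `a, x ≥ 0` give
`(a·A₀)·L·M²·x ≤ G_ψ(r)`, with thresholds the maxima of the two factors'. [folklore] -/
theorem widthHaldaneBridge_of_columnWeight_of_relativeLaw
    (hT : ∀ U : ℝ, 0 < U → ∀ δ ∈ Set.Ioo (0 : ℝ) (3 / 10), ∀ (d₀ k₀ : ℝ) (M₁ L₀ : ℕ), 0 < d₀ →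
      UniformThermo U δ d₀ k₀ M₁ L₀ →
        ∃ A₀ : ℝ, 0 < A₀ ∧ ∃ M₂ L₁ : ℕ, ∀ (L M : ℕ) [NeZero L] [NeZero M], Even L → Even M →
          M₂ ≤ M → M ≤ L → L₁ ≤ L → ∀ (Λ : Type) [LinearOrder Λ] [Fintype Λ]
            (e : Λ ≃ ZMod L × ZMod M) (ψ : Fock (Orb Λ)), star ψ ⬝ᵥ ψ = 1 →
              IsGroundStateInSector (tubeH0 L M Λ e U) (tubeFilling L M δ) 0 ψ →
                A₀ * (L : ℝ) * (M : ℝ) ^ 2 ≤ tubeColumnPairCorr L M Λ e ψ 0)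
    (hL : ∀ U : ℝ, 0 < U → ∀ δ ∈ Set.Ioo (0 : ℝ) (3 / 10), ∀ (d₀ k₀ : ℝ) (M₁ L₀ : ℕ), 0 < d₀ →
      UniformThermo U δ d₀ k₀ M₁ L₀ →
        ∃ Ξ : ℝ, 0 < Ξ ∧ ∃ a : ℝ, 0 < a ∧ ∃ R M₂ L₁ : ℕ, ∀ (L M : ℕ) [NeZero L] [NeZero M],
          Even L → Even M → M₂ ≤ M → M ≤ L → L₁ ≤ L → ∀ (Λ : Type) [LinearOrder Λ] [Fintype Λ]
            (e : Λ ≃ ZMod L × ZMod M) (ψ : Fock (Orb Λ)), star ψ ⬝ᵥ ψ = 1 →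
              IsGroundStateInSector (tubeH0 L M Λ e U) (tubeFilling L M δ) 0 ψ →
                ∀ r : ZMod L, R ≤ r.val → r.val + R ≤ L →
                  a * tubeColumnPairCorr L M Λ e ψ 0 *
                      ((min r.val (L - r.val) : ℕ) : ℝ) ^
                        (-(Ξ * Real.sqrt (tubePairCompressibility L M Λ e U δ /
                          tubeStiffness L M Λ e U δ) / (M : ℝ))) ≤
                    tubeColumnPairCorr L M Λ e ψ r) :
    WidthHaldaneBridge := by
  rw [widthHaldaneBridge_iff]
  intro U hU δ hδ d₀ k₀ M₁ L₀ hd₀ hth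
  obtain ⟨A₀, hA₀, M₂, L₁, hTw⟩ := hT U hU δ hδ d₀ k₀ M₁ L₀ hd₀ hth
  obtain ⟨Ξ, hΞ, a, ha, R, M₂', L₁', hLw⟩ := hL U hU δ hδ d₀ k₀ M₁ L₀ hd₀ hth
  refine ⟨Ξ, hΞ, a * A₀, mul_pos ha hA₀, R, max M₂ M₂', max L₁ L₁', ?_⟩
  intro L M _ _ hLe hMe hM hML hLL Λ _ _ e ψ hψ hGS r hr hrL
  have h0 := hTw L M hLe hMe (le_of_max_le_left hM) hML (le_of_max_le_left hLL) Λ e ψ hψ hGS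
  have h1 := hLw L M hLe hMe (le_of_max_le_right hM) hML (le_of_max_le_right hLL) Λ e ψ hψ hGS
    r hr hrL
  have hx : 0 ≤ ((min r.val (L - r.val) : ℕ) : ℝ) ^
      (-(Ξ * Real.sqrt (tubePairCompressibility L M Λ e U δ / tubeStiffness L M Λ e U δ) /
        (M : ℝ))) := Real.rpow_nonneg (Nat.cast_nonneg _) _
  calc a * A₀ * (L : ℝ) * (M : ℝ) ^ 2 * _ = a * (A₀ * (L : ℝ) * (M : ℝ) ^ 2) * _ := by ring
    _ ≤ a * tubeColumnPairCorr L M Λ e ψ 0 * _ :=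
        mul_le_mul_of_nonneg_right (mul_le_mul_of_nonneg_left h0 ha.le) hx
    _ ≤ tubeColumnPairCorr L M Λ e ψ r := h1

/-- **The column factorisation is exact**: `WidthHaldaneBridge` holds iff BOTH factor T
(width-uniform equal-column weight under `UniformThermo`) and factor L (the amplitude-free
Haldane-form law under `UniformThermo`) hold. So the line `column_factorisation` loses no strength:
its two stubs are jointly EQUIVALENT to the crux (`→`: `columnWeight_of_widthHaldaneBridge`,
`relativeLaw_of_widthHaldaneBridge`; `←`: `widthHaldaneBridge_of_columnWeight_of_relativeLaw`).
[folklore] -/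
theorem widthHaldaneBridge_iff_columnFactorisation :
    WidthHaldaneBridge ↔
      (∀ U : ℝ, 0 < U → ∀ δ ∈ Set.Ioo (0 : ℝ) (3 / 10), ∀ (d₀ k₀ : ℝ) (M₁ L₀ : ℕ), 0 < d₀ →
        UniformThermo U δ d₀ k₀ M₁ L₀ →
          ∃ A₀ : ℝ, 0 < A₀ ∧ ∃ M₂ L₁ : ℕ, ∀ (L M : ℕ) [NeZero L] [NeZero M], Even L → Even M →
            M₂ ≤ M → M ≤ L → L₁ ≤ L → ∀ (Λ : Type) [LinearOrder Λ] [Fintype Λ]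
              (e : Λ ≃ ZMod L × ZMod M) (ψ : Fock (Orb Λ)), star ψ ⬝ᵥ ψ = 1 →
                IsGroundStateInSector (tubeH0 L M Λ e U) (tubeFilling L M δ) 0 ψ →
                  A₀ * (L : ℝ) * (M : ℝ) ^ 2 ≤ tubeColumnPairCorr L M Λ e ψ 0) ∧
      (∀ U : ℝ, 0 < U → ∀ δ ∈ Set.Ioo (0 : ℝ) (3 / 10), ∀ (d₀ k₀ : ℝ) (M₁ L₀ : ℕ), 0 < d₀ →
        UniformThermo U δ d₀ k₀ M₁ L₀ →
          ∃ Ξ : ℝ, 0 < Ξ ∧ ∃ a : ℝ, 0 < a ∧ ∃ R M₂ L₁ : ℕ, ∀ (L M : ℕ) [NeZero L] [NeZero M],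
            Even L → Even M → M₂ ≤ M → M ≤ L → L₁ ≤ L → ∀ (Λ : Type) [LinearOrder Λ] [Fintype Λ]
              (e : Λ ≃ ZMod L × ZMod M) (ψ : Fock (Orb Λ)), star ψ ⬝ᵥ ψ = 1 →
                IsGroundStateInSector (tubeH0 L M Λ e U) (tubeFilling L M δ) 0 ψ →
                  ∀ r : ZMod L, R ≤ r.val → r.val + R ≤ L →
                    a * tubeColumnPairCorr L M Λ e ψ 0 *
                        ((min r.val (L - r.val) : ℕ) : ℝ) ^
                          (-(Ξ * Real.sqrt (tubePairCompressibility L M Λ e U δ /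
                            tubeStiffness L M Λ e U δ) / (M : ℝ))) ≤
                      tubeColumnPairCorr L M Λ e ψ r) :=
  ⟨fun h => ⟨columnWeight_of_widthHaldaneBridge h, relativeLaw_of_widthHaldaneBridge h⟩,
    fun h => widthHaldaneBridge_of_columnWeight_of_relativeLaw h.1 h.2⟩

end Summit.HubbardSuperconductivity.HubbardSuperconductivity.Theorems.WidthHaldane

end
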